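import Mathlib
import HarnessLib
import Literature.Analysis.FluidPDE.SelfSimilar
import Literature.Analysis.FluidPDE.VectorCalculus
import Summits.NavierStokesRegularity.NavierStokesRegularity.Theorems.UnthreadedDoorToroidalPotential
import Summits.NavierStokesRegularity.NavierStokesRegularity.Theorems.UnthreadedDoorAntidynamoSingleDegreeVorticity

/-!
# Route `UnthreadedDoor` / `ThreadingFlux`, crux `PoloidalLiouville` (stmt-NavierStokesRegularity-1222), antidynamo v2 skeleton
# (sha16 `4ebf5683127b`), rung `stub_singleDegreeRung` (BC5): STEP S3 — A CANONICAL, JOINTLY SMOOTH RADIAL COEFFICIENT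
# `G(t, r) = ⟪curl v(t)(x₀ + rθ₁), Λ(rθ₁)⟫ / ‖Λ(rθ₁)‖²` with `curl v(t)(x) = G(t, ‖x − x₀‖) • Λ(x − x₀)`

Support file (seat leafhand-ns-unthreadeddoor-1 g0, cell decomp-ns), `--supports stmt-NavierStokesRegularity-1222 --as helper`; theorems only.
Continues `…AntidynamoSingleDegreeVorticity` (p797227, step S2 under the rung's hypotheses).  The coefficient `ĝ(t, ·)` produced there
slice by slice is replaced by the explicit formula above along ONE fixed good direction `θ₁` (`Λ θ₁ ≠ 0`; it exists because `Λ` is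
non-zero densely), which makes the joint regularity in `(t, r)` immediate from the joint smoothness of the vorticity on the slab
(tree `PoloidalLiouville.contDiffOn_uncurry_curl`):

* ★★ `singleDegree_vorticity_coefficient` — under the hypotheses of `singleDegree_vorticity_structure` there are a unit vector `θ₁` and
  `G : ℝ → ℝ → ℝ`, `C^∞` jointly on `(−∞,0) × (0,∞)`, with `curl (v t) x = G t ‖x − x₀‖ • (∇P(x − x₀) × (x − x₀))` for all `t < 0`,
  `x ≠ x₀`.

WHAT REMAINS for the rung without the wall (census): S4 `Δ(G(t,‖·‖)Λ) = (∂ᵣ²G + (2l+2) r⁻¹ ∂ᵣG)Λ`, and S5 the dynamics.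
HONEST LABEL: step S3 only; nothing here proves the rung, the wall, `PoloidalLiouville` (1222) or bears on NS regularity. [folklore]
-/

noncomputable section

-- the summit and its single sub-problem share the name (CONVENTIONS §1)
set_option linter.dupNamespace false

open scoped Topology InnerProductSpace RealInnerProductSpace ContDiff Laplacian
open Filter Set Function Metric MeasureTheory MvPolynomial
open Literature.Analysis.FluidPDE

namespace Summit.NavierStokesRegularity.NavierStokesRegularity.Theorems.PoloidalLiouville.Antidynamo

/-- ★★ STEP S3: a canonical jointly smooth radial coefficient for the single-degree vorticity.  See the module docstring. [folklore] -/
theorem singleDegree_vorticity_coefficient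
    (v : ℝ → EuclideanSpace ℝ (Fin 3) → EuclideanSpace ℝ (Fin 3)) (x₀ : EuclideanSpace ℝ (Fin 3))
    (hB : Literature.Analysis.FluidPDE.IsBoundedAncientMildSolution 1 v)
    (hm : ∀ t < 0, AEStronglyMeasurable (v t) volume)
    (hsm : ContDiffOn ℝ (⊤ : ℕ∞) (Function.uncurry v) (Set.Iio 0 ×ˢ Set.univ))
    {l : ℕ} {P : MvPolynomial (Fin 3) ℝ} (hl : 2 ≤ l) (hP : P.IsHomogeneous l) (hP0 : P ≠ 0)
    (hharm : ∀ y : EuclideanSpace ℝ (Fin 3),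
      Laplacian.laplacian (fun z : EuclideanSpace ℝ (Fin 3) => MvPolynomial.eval (fun i => z i) P) y = 0)
    (hrep : ∀ t < 0, ∃ (g : ℝ → ℝ) (φ : EuclideanSpace ℝ (Fin 3) → ℝ), ∀ x,
      v t x = gradient φ x + (g ‖x - x₀‖ * MvPolynomial.eval (fun i => (x - x₀) i) P) • (x - x₀)) :
    ∃ (θ₁ : EuclideanSpace ℝ (Fin 3)) (G : ℝ → ℝ → ℝ), ‖θ₁‖ = 1 ∧
      ContDiffOn ℝ ∞ (Function.uncurry G) (Set.Iio 0 ×ˢ Set.Ioi 0) ∧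
      ∀ t < 0, ∀ x : EuclideanSpace ℝ (Fin 3), x ≠ x₀ →
        curl (v t) x = G t ‖x - x₀‖ •
          cross (gradient (fun z : EuclideanSpace ℝ (Fin 3) => MvPolynomial.eval (fun i => z i) P) (x - x₀)) (x - x₀) := by
  set Q : EuclideanSpace ℝ (Fin 3) → ℝ := fun z => MvPolynomial.eval (fun i => z i) P with hQ
  have hQω : ContDiff ℝ ω Q := contDiff_omega_evalPoly P
  have hQhom : ∀ r : ℝ, 0 < r → ∀ y : EuclideanSpace ℝ (Fin 3), Q (r • y) = r ^ l * Q y :=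
    fun r _ y => evalPoly_smul hP r y
  have hl1 : 1 ≤ l := by omega
  have hQne : ∃ y, Q y ≠ 0 := exists_evalPoly_ne_zero hP0
  -- a good direction
  obtain ⟨y₁, -, hΛy₁⟩ := exists_cross_gradient_ne_zero_of_isOpen hQω hl1 hQhom hharm hQne isOpen_univ univ_nonempty
  have hy₁0 : y₁ ≠ 0 := by
    intro h0; apply hΛy₁; rw [h0, ← crossCLM_apply, map_zero]
  set ρ₁ : ℝ := ‖y₁‖ with hρ₁
  have hρ₁0 : 0 < ρ₁ := norm_pos_iff.2 hy₁0
  set θ₁ : EuclideanSpace ℝ (Fin 3) := ρ₁⁻¹ • y₁ with hθ₁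
  have hθ₁1 : ‖θ₁‖ = 1 := by
    rw [hθ₁, norm_smul, Real.norm_eq_abs, abs_of_pos (inv_pos.2 hρ₁0), inv_mul_cancel₀ hρ₁0.ne']
  have hΛθ : ∀ r : ℝ, 0 < r → cross (gradient Q (r • θ₁)) (r • θ₁) ≠ 0 := by
    intro r hr
    have : r • θ₁ = (r * ρ₁⁻¹) • y₁ := by rw [hθ₁, smul_smul]
    rw [this]
    exact cross_gradient_ne_zero_smul (hQω.differentiable (by simp)) hQhom hΛy₁ (mul_pos hr (inv_pos.2 hρ₁0))
  -- the canonical coefficient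
  set G : ℝ → ℝ → ℝ := fun t r =>
    ⟪curl (v t) (x₀ + r • θ₁), cross (gradient Q (r • θ₁)) (r • θ₁)⟫ / ‖cross (gradient Q (r • θ₁)) (r • θ₁)‖ ^ 2 with hG
  refine ⟨θ₁, G, hθ₁1, ?_, ?_⟩
  · -- joint smoothness on `(−∞,0) × (0,∞)`
    have hcurl : ContDiffOn ℝ ∞ (uncurry fun t x => curl (v t) x) (Iio 0 ×ˢ univ) := contDiffOn_uncurry_curl hsm
    have hmap : ContDiff ℝ ∞ fun p : ℝ × ℝ => (p.1, x₀ + p.2 • θ₁) :=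
      contDiff_fst.prodMk (contDiff_const.add (contDiff_snd.smul contDiff_const))
    have hmaps : MapsTo (fun p : ℝ × ℝ => (p.1, x₀ + p.2 • θ₁)) (Iio 0 ×ˢ Ioi 0) (Iio 0 ×ˢ univ) :=
      fun p hp => ⟨hp.1, mem_univ _⟩
    have h1 : ContDiffOn ℝ ∞ (fun p : ℝ × ℝ => curl (v p.1) (x₀ + p.2 • θ₁)) (Iio 0 ×ˢ Ioi 0) :=
      hcurl.comp hmap.contDiffOn hmaps
    have hΛs : ContDiff ℝ ∞ fun p : ℝ × ℝ => cross (gradient Q (p.2 • θ₁)) (p.2 • θ₁) :=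
      ((contDiff_omega_cross_gradient hQω).of_le le_top).comp (contDiff_snd.smul contDiff_const)
    have hnum : ContDiffOn ℝ ∞ (fun p : ℝ × ℝ => ⟪curl (v p.1) (x₀ + p.2 • θ₁), cross (gradient Q (p.2 • θ₁)) (p.2 • θ₁)⟫)
        (Iio 0 ×ˢ Ioi 0) := h1.inner ℝ hΛs.contDiffOn
    have hden : ContDiffOn ℝ ∞ (fun p : ℝ × ℝ => ‖cross (gradient Q (p.2 • θ₁)) (p.2 • θ₁)‖ ^ 2) (Iio 0 ×ˢ Ioi 0) :=
      (hΛs.norm_sq ℝ).contDiffOn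
    have hq := hnum.div hden (fun p hp => pow_ne_zero _ (norm_ne_zero_iff.2 (hΛθ p.2 hp.2)))
    exact hq
  · intro t ht x hx
    obtain ⟨ĝ, -, hcurl⟩ := singleDegree_vorticity_structure v x₀ hB hm hsm hl hP hP0 hharm hrep t ht
    set r : ℝ := ‖x - x₀‖ with hr
    have hr0 : 0 < r := norm_pos_iff.2 (sub_ne_zero.2 hx)
    -- evaluate the structure at the ray point `x₀ + r θ₁`
    have hray : x₀ + r • θ₁ ≠ x₀ := by
      intro h
      have : r • θ₁ = 0 := by simpa using h
      rcases smul_eq_zero.1 this with h1 | h1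
      · exact hr0.ne' h1
      · have := hθ₁1; rw [h1, norm_zero] at this; exact zero_ne_one this
    have h2 := hcurl (x₀ + r • θ₁) hray
    have hn : ‖x₀ + r • θ₁ - x₀‖ = r := by
      rw [add_sub_cancel_left, norm_smul, Real.norm_eq_abs, abs_of_pos hr0, hθ₁1, mul_one]
    rw [hn, add_sub_cancel_left] at h2
    have hGt : G t r = ĝ r := by
      have hne : ‖cross (gradient Q (r • θ₁)) (r • θ₁)‖ ^ 2 ≠ 0 := pow_ne_zero _ (norm_ne_zero_iff.2 (hΛθ r hr0))
      simp only [hG]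
      rw [h2, real_inner_smul_left, real_inner_self_eq_norm_sq]
      exact mul_div_cancel_right₀ _ hne
    rw [hGt]
    exact hcurl x hx

end Summit.NavierStokesRegularity.NavierStokesRegularity.Theorems.PoloidalLiouville.Antidynamo

end
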